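import Literature.Computability.Cryptography.LWERoundingBridges
import Literature.Computability.Cryptography.LWEPrimePowerSolverData
import Literature.Computability.Cryptography.UniformResidueSampling
import Literature.Probability.Distributions.GaussianRejectionSampler
import HarnessLib

/-!
# The machine's modulus-switch kernel at the level of laws: what the finite-precision samplers draw, and its distance to the recipe

Topic `Computability/Cryptography` (LWE), grouping namespace `BLPRS2013`; sequel of `LWESwitchSamplingForm.lean`
(`samplingPMF`: the recipe `kⱼ ← D_{ℤ,q'r,q'aⱼ/Q}`, `(u, w) ← U[-½,½) ⊗ D_σ`, `a' = k mod q'`,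
`b̄' = ⟨a',t⟩ + ⌊q'b̄/Q + q'u/Q + q'w⌉`, equal to the point kernel `switchPoint` of Cor. 3.2) and of
`LWERoundingBridges.lean` (`coinRoundLaw`: the coin-driven law of the rounded continuous part). A coin-driven
machine replaces each ingredient by a sampler of the tree — the integers `kⱼ` by GPV's rejection sampler with exact
rational arithmetic (`GaussRej.rejLaw θ c s N P w R`, `GaussianRejectionSampler.lean`; the width is `√(π/θ)` for a
RATIONAL `θ`, so the reduction's radius is `r = √(π/θ)/q'`), the rounded part by `coinRoundLaw` on an integer
sampler `ℓ` (the pseudo-Gaussian sampler `PGParams.lawPMF`), the secret shift `t ← U(ℤ_{q'}ⁿ)` by residues of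
uniform coin blocks (`LWE.modLaw M q'`, `UniformResidueSampling.lean`). This file writes these laws down and
bounds their distance to the ideal ones (everything PROVED, definitions with bodies, no named fact):

* `centre Q q' a = q'·a/Q ∈ ℚ` (`cast_centre`), **`machSamplePMF`** (one sample), **`machRowPMF`** (a block:
  shift from residues, then the samples independently);
* **`tvDist_machSamplePMF_samplingPMF_le`** — `Δ ≤ n·ρ + (Δ(ℓ, ℓ_b) + (s+4)(2/s)(δ₀ + (3/2)|κ̂ - q'σ/√π|))`,
  `ρ` any uniform bound on the rejection sampler's distance to `D_{ℤ,√(π/θ),c}` (`GaussRej.tvDist_rejLaw_le_of_params`),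
  `σ² = (rB)² + τ²` (`tvDist_indepLaw_le`, `tvDist_bind_bind_le`, `tvDist_coinRoundLaw_map_roundLaw_le`);
* `tvDist_piLaw_le_of_forall_le`, **`tvDist_machRowPMF_le`** — for a block of `m` samples,
  `Δ(machine row, U(t) ≫= switchKernelPMF) ≤ n·q'/M + m·(per-sample bound)` (`switchKernelPMF_eq`,
  `LWE.tvDist_iidPMF_modLaw_le`).

## References

* Z. Brakerski, A. Langlois, C. Peikert, O. Regev, D. Stehlé, *Classical hardness of learning with errors*, STOC 2013;
  arXiv:1306.0281, Lemma 3.5 / Cor. 3.2 (the map), Lemma 2.3 and §5 (efficient sampling to within negligible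
  statistical distance). [BrakerskiEtAl2013]
* C. Gentry, C. Peikert, V. Vaikuntanathan, *Trapdoors for hard lattices and new cryptographic constructions*,
  STOC 2008, §4.1 (SampleZ). [GentryPeikertVaikuntanathan2008]
* O. Regev, *On lattices, learning with errors …*, J. ACM 56 (2009), Lemma 4.1 (proof: the uniform shift `t`).
  [RegevLWE2009]
* O. Goldreich, *Foundations of Cryptography I*, CUP 2001, §3.2.2–§3.2.3 (data processing, independent samples).
  [Goldreich2001]
-/

noncomputable section

open MeasureTheory Literature.Algebra.EuclideanLattices Literature.Probability.Distributions
open scoped Real ENNReal NNReal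

namespace Literature.Computability.Cryptography

namespace BLPRS2013

open LWE LWE.MP12

/-! ### Products over `Fin m` -/

/-- **Independent coordinates, coordinatewise close laws**: `Δ(⨂ᵢ fᵢ, ⨂ᵢ gᵢ) ≤ m·δ` if `Δ(fᵢ, gᵢ) ≤ δ` for all `i`.
[cite: Goldreich2001, §3.2.3] -/
theorem tvDist_piLaw_le_of_forall_le {X : Type} [Fintype X] {m : ℕ} (f g : Fin m → PMF X) {δ : ℝ}
    (h : ∀ i, (f i).tvDist (g i) ≤ δ) : (piLaw f).tvDist (piLaw g) ≤ m * δ := by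
  rw [← indepLaw_eq_piLaw, ← indepLaw_eq_piLaw]
  refine (tvDist_indepLaw_le m f g).trans ?_
  calc ∑ i, (f i).tvDist (g i) ≤ ∑ _i : Fin m, δ := Finset.sum_le_sum fun i _ => h i
    _ = m * δ := by rw [Finset.sum_const, Finset.card_univ, Fintype.card_fin, nsmul_eq_mul]

/-! ### One sample -/

section Sample

variable (n Q q' : ℕ)

/-- **The centre of the `j`-th integer**, `q'·a/Q`, as a rational number (`a ∈ {0,…,Q-1}` the lift).
[cite: BrakerskiEtAl2013, Lemma 3.5 (the map: `f ← D_{Λ - a, r}`)] -/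
def centre (a : ZMod Q) : ℚ := ((q' * a.val : ℕ) : ℚ) / Q

/-- The centre as a real number. [folklore] -/
theorem cast_centre (a : ZMod Q) : ((centre Q q' a : ℚ) : ℝ) = (q' : ℝ) * ((a.val : ℝ) / Q) := by
  unfold centre
  push_cast
  ring

variable [NeZero Q] [NeZero q'] (θ : ℚ) (s N Pr w R : ℕ) (κh : ℚ) (b P : ℕ) (ℓ : PMF ℤ) (t : Fin n → ZMod q')

/-- **The machine's kernel on one sample** `(a, b̄) ↦ (a', b̄')`: `kⱼ ← rejLaw θ (q'aⱼ/Q) …` (GPV's sampler for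
`D_{ℤ,√(π/θ),q'aⱼ/Q}`), `a' = k mod q'`, `b̄' = ⟨a', t⟩ + (coinRoundLaw (q'b̄/Q) κ̂ b P ℓ mod q')`.
[cite: BrakerskiEtAl2013, Lemma 3.5 (the map) with §5; GentryPeikertVaikuntanathan2008, §4.1] -/
def machSamplePMF (p : (Fin n → ZMod Q) × ZMod Q) : PMF ((Fin n → ZMod q') × ZMod q') :=
  (indepLaw n fun j => GaussRej.rejLaw θ (centre Q q' (p.1 j)) s N Pr w R).bind fun k =>
    ((coinRoundLaw Q q' ((centre Q q' p.2 : ℚ) : ℝ) (κh : ℝ) b P ℓ).map fun z : ℤ => (z : ZMod q')).map fun z =>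
      (fun j => (k j : ZMod q'), (fun j => (k j : ZMod q')) ⬝ᵥ t + z)

variable {n Q q' θ s N Pr w R κh b P ℓ t}

/-- **One machine sample is close to the recipe**: with `r = √(π/θ)/q'` and `σ² = (rB)² + τ²`,
`Δ(machSamplePMF, samplingPMF) ≤ n·ρ + (Δ(ℓ, ℓ_b) + (s+4)(2/s)(δ₀ + (3/2)|κ̂ - q'σ/√π|))`, `s = q'/Q`,
`δ₀ = s·2^{-(P+1)} + |κ̂|·2^{-(b+1)}`, for any uniform bound `ρ` on the rejection sampler's distance to
`D_{ℤ,√(π/θ),c}`. [cite: BrakerskiEtAl2013, §5 with Lemma 2.3; Goldreich2001, §3.2.2–§3.2.3] -/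
theorem tvDist_machSamplePMF_samplingPMF_le {ρ : ℝ}
    (hrej : ∀ c : ℚ, (GaussRej.rejLaw θ c s N Pr w R).tvDist (discreteGaussianInt (Real.sqrt (π / θ)) c) ≤ ρ)
    (B τ : ℝ) (p : (Fin n → ZMod Q) × ZMod Q) :
    (machSamplePMF n Q q' θ s N Pr w R κh b P ℓ t p).tvDist (samplingPMF n Q q' (Real.sqrt (π / θ) / q') B τ t p) ≤
      n * ρ + (ℓ.tvDist (gaussBoxPMF b) + ((q' : ℝ) / Q + 4) * (2 / ((q' : ℝ) / Q)) *
        (((q' : ℝ) / Q * (1 / 2 ^ (P + 1)) + |(κh : ℝ)| * (1 / 2 ^ (b + 1))) +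
          3 / 2 * |(κh : ℝ) - (q' : ℝ) * Real.sqrt ((Real.sqrt (π / θ) / q' * B) ^ 2 + τ ^ 2) / √π|)) := by
  have hq : (q' : ℝ) ≠ 0 := by exact_mod_cast NeZero.ne q'
  -- the recipe with its centres and width in the machine's form
  have hD : (fun j => discreteGaussianInt ((q' : ℝ) * (Real.sqrt (π / θ) / q')) ((q' : ℝ) * ((((p.1 j).val : ℕ) : ℝ) / Q))) =
      fun j => discreteGaussianInt (Real.sqrt (π / θ)) ((centre Q q' (p.1 j) : ℚ) : ℝ) := by
    funext j
    rw [mul_div_cancel₀ _ hq, cast_centre]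
  have hc : (q' : ℝ) * (((p.2.val : ℕ) : ℝ) / Q) = ((centre Q q' p.2 : ℚ) : ℝ) := (cast_centre Q q' p.2).symm
  rw [samplingPMF, hD, hc, machSamplePMF]
  refine (PMF.tvDist_bind_bind_le _ _ _ _ fun k => ?_).trans (add_le_add ?_ le_rfl)
  · exact (PMF.tvDist_map_le_holds _ _ _).trans (tvDist_coinRoundLaw_map_roundLaw_le Q q' _ _ _ b P ℓ)
  · refine (tvDist_indepLaw_le n _ _).trans ?_
    calc ∑ j, (GaussRej.rejLaw θ (centre Q q' (p.1 j)) s N Pr w R).tvDist (discreteGaussianInt (Real.sqrt (π / θ)) (centre Q q' (p.1 j)))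
        ≤ ∑ _j : Fin n, ρ := Finset.sum_le_sum fun j _ => hrej _
      _ = n * ρ := by rw [Finset.sum_const, Finset.card_univ, Fintype.card_fin, nsmul_eq_mul]

end Sample

/-! ### A block of samples: the secret shift from coin residues, then the samples independently -/

section Row

variable (n Q q' : ℕ) [NeZero Q] [NeZero q'] (θ : ℚ) (s N Pr w R : ℕ) (κh : ℚ) (b P : ℕ) (ℓ : PMF ℤ)
  (M : ℕ) [NeZero M] (m : ℕ)

/-- **The machine's kernel on a block** of `m` samples: `t` as `n` residues mod `q'` of uniform coin blocks
`< M`, then `machSamplePMF` on each sample independently. [cite: BrakerskiEtAl2013, Cor. 3.2 with Lemma 2.15; RegevLWE2009, Lemma 4.1 (proof)] -/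
def machRowPMF (S : Fin m → (Fin n → ZMod Q) × ZMod Q) : PMF (Fin m → (Fin n → ZMod q') × ZMod q') :=
  (iidPMF (modLaw M q') n).bind fun t => piLaw fun i => machSamplePMF n Q q' θ s N Pr w R κh b P ℓ t (S i)

variable {n Q q' θ s N Pr w R κh b P ℓ M m}

/-- **A machine block is close to the ideal row** `t ← U(ℤ_{q'}ⁿ)`, then the reduction's kernel `switchKernelPMF`
of Cor. 3.2 (radius `r = √(π/θ)/q'`, bound `B`, raising `τ`):
`Δ ≤ n·q'/M + m·(n·ρ + (Δ(ℓ, ℓ_b) + (s+4)(2/s)(δ₀ + (3/2)|κ̂ - q'σ/√π|)))`.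
[cite: BrakerskiEtAl2013, Cor. 3.2 and §5; RegevLWE2009, Lemma 4.1 (proof); Goldreich2001, §3.2.3] -/
theorem tvDist_machRowPMF_le (hθ : 0 < θ) {ρ : ℝ}
    (hrej : ∀ c : ℚ, (GaussRej.rejLaw θ c s N Pr w R).tvDist (discreteGaussianInt (Real.sqrt (π / θ)) c) ≤ ρ)
    (B τ : ℝ) (S : Fin m → (Fin n → ZMod Q) × ZMod Q) :
    (machRowPMF n Q q' θ s N Pr w R κh b P ℓ M m S).tvDist
        ((PMF.uniformOfFintype (Fin n → ZMod q')).bind fun t => switchKernelPMF n Q q' (Real.sqrt (π / θ) / q') B τ t m S) ≤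
      n * ((q' : ℝ) / M) + m * (n * ρ + (ℓ.tvDist (gaussBoxPMF b) + ((q' : ℝ) / Q + 4) * (2 / ((q' : ℝ) / Q)) *
        (((q' : ℝ) / Q * (1 / 2 ^ (P + 1)) + |(κh : ℝ)| * (1 / 2 ^ (b + 1))) +
          3 / 2 * |(κh : ℝ) - (q' : ℝ) * Real.sqrt ((Real.sqrt (π / θ) / q' * B) ^ 2 + τ ^ 2) / √π|))) := by
  have hq : (0 : ℝ) < q' := by exact_mod_cast Nat.pos_of_ne_zero (NeZero.ne q')
  have hθ' : (0 : ℝ) < (θ : ℝ) := by exact_mod_cast hθ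
  have hr : 0 < Real.sqrt (π / θ) / q' := div_pos (Real.sqrt_pos.2 (div_pos Real.pi_pos hθ')) hq
  have hK : ∀ t : Fin n → ZMod q', switchKernelPMF n Q q' (Real.sqrt (π / θ) / q') B τ t m S =
      piLaw fun i => samplingPMF n Q q' (Real.sqrt (π / θ) / q') B τ t (S i) := fun t => switchKernelPMF_eq hr m S
  simp_rw [hK]
  unfold machRowPMF
  refine (PMF.tvDist_bind_bind_le _ _ _ _ fun t => ?_).trans (add_le_add (tvDist_iidPMF_modLaw_le M q' n) le_rfl)
  exact tvDist_piLaw_le_of_forall_le _ _ fun i => tvDist_machSamplePMF_samplingPMF_le hrej B τ (S i)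

end Row

end BLPRS2013

end Literature.Computability.Cryptography

end
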